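import Mathlib
import HarnessLib
import HarnessLib.Audit
import Summits.Langlands.Statement
import HarnessLib.Audit.Check
import Literature.NumberTheory.GaloisRepresentations.OrdinaryGaloisRep
import Literature.NumberTheory.GaloisRepresentations.CrystallineDeformationRing
import Literature.NumberTheory.GaloisRepresentations.LabelledHodgeTateWeights
import Literature.NumberTheory.Automorphic.CompletedCohomologyHeckeAlgebraGLn
import Literature.NumberTheory.Automorphic.QuaternionicForms
import Literature.NumberTheory.Automorphic.QuaternionFiniteAdeleUnitsDecomposition
import Literature.NumberTheory.Automorphic.GLnAdelicStructure
import HarnessLib.Audit.Status.Attr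

/-!
Route: EisensteinGelfandKirillov

DORMANT since 2026-08-25T10:10:24Z (reconciler: no traction for 7.6 d (last activity item-evidence-added at 2026-08-17T19:11:10Z); parked, not closed — `ledger route dormant route-Langlands-EisensteinGelfandKirillov --off` to reactivate) — unstaffed, not closed; items shared with open routes are served there. `ledger route dormant <id> --off` reactivates.

# Route EisensteinGelfandKirillov — Eisenstein Gelfand–Kirillov bound replaces p-adic local
Langlands for reducible non-ordinary Hilbert FM

BARRIER-INVERSION route (lens v3 §3.2). WALL =
`Literature.Barriers.Langlands.ModPLanglandsGL2BeyondQp` (the GL₂(ℚ_p)-specific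
local input of Kisin/Emerton/Pan-type Fontaine–Mazur proofs; its Lean content is the Breuil–Paškūnas
infinitude of supersingular
representations for F_v ≠ ℚ_p). It suffices to show X = `ReducibleCrystallineModular`: for F totally
real, p ≥ 5 UNRAMIFIED in F
(F_v ≠ ℚ_p allowed), every irreducible, totally odd, a.e. unramified ρ : Γ_F → GL₂(ℚ̄_p) with a
residually UPPER-TRIANGULAR integral
model (ρ̄^ss = χ̄_a ⊕ χ̄_b) that is p-distinguished and CRYSTALLINE with distinct labelled
Hodge–Tate weights at every v ∣ p (pinned
Fontaine datum) — ordinarity NOT assumed — is modular (Satake–Frobenius matching a.e. with an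
L-algebraic cuspidal π on GL₂(𝔸_F)).
X is reached as DOOR → ENGINE → EXIT: the door `EisensteinGKBound` (Gee–Newton's codimension
inequality at an EISENSTEIN maximal
ideal, in growth form: the χ̄₁⊕χ̄₂-torsion of mod-p totally definite quaternionic forms of level
Ô^p·(1+p^rÔ_p) has dimension
≤ C·p^(r[F:ℚ]), i.e. Gelfand–Kirillov dimension ≤ [F:ℚ]); the engine `ProModularOfGKBound` (door ⇒
pro-modularity of every ρ of
the sector, by Pan's patching at Skinner–Wiles nice primes with Gee–Newton miracle flatness in place
of Paškūnas' Bernstein-centre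
theorem); the exit `CrystallineProModularClassical` (crystalline HT-regular pro-modular ⇒
classical). `SectorComplement` = the rest
of the summit, declared. No idea card realised (lens route).
Lean: `ReducibleCrystallineModular ∧ (ReducibleCrystallineModular → _root_.Langlands)`

## Assembly
Pure logic (glue.lean, sorry-free): `closes h₂ h₃ h₄ h₉ := h₉ (target_of (h₃ h₂) h₄)` where
`target_of` instantiates the
engine's pro-modularity (door fed in) and the exit's classicality at the target's binders (the
target's local hypothesis at v ∣ p
splits into p-distinguishedness for the engine and crystalline + HT-regular for the exit). Every
binder of `closes` is a crux.

Rationale: WHY THIS LINE. Every residually reducible Fontaine–Mazur theorem for GL₂ is either ORDINARY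
(SkinnerWiles1999, Zhang2024 = arXiv:2411.18661) or needs
F_v = ℚ_p (Pan2022 over ℚ; X. Zhang arXiv:2512.21249, F abelian with p split completely), because
Pan's patching of completed
homology at a nice prime solves its two printed difficulties (lower bound for dim 𝕋; finite
generation / faithfulness of patched
completed homology) with Paškūnas' GL₂(ℚ_p) Bernstein-centre theorem (Paskunas2013 Thm 1.5) —
exactly the hypothesis the catalogued
wall forbids for F_v ≠ ℚ_p. Gee–Newton (GeeNewton2020 §1) isolated what is REALLY needed: one
codimension inequality for the 𝔪-fibre
of completed cohomology ("even in l₀ = 0 situations, we do not know how to establish this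
codimension inequality — if we did, our
methods would give a new approach to proving big R = 𝕋"), and Breuil–Herzig–Hu–Morra–Schraen
(BreuilEtAl2023 Thm 1.1/1.4/1.6, with
HuWang2020 for non-semisimple ρ̄_v) PROVED it — GK-dimension = [F_v:ℚ_p] — for NON-Eisenstein
generic 𝔪 and F_v unramified, by a
purely local Iwahori-socle criterion fed by patched multiplicity one, deducing big R = 𝕋 and
flatness with no p-adic local
Langlands at all (their Thm 1.2). The new lever: run the same inequality at an EISENSTEIN maximal
ideal (where Taylor–Wiles
hypotheses fail but BHHMS's criterion Thm 1.6 is local and hypothesis-free) and feed it to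
Gee–Newton's miracle flatness at a
Skinner–Wiles/Pan nice prime instead of at 𝔪; the sector it opens (reducible ρ̄, non-ordinary ρ, F_v
≠ ℚ_p — e.g. abelian surfaces
of GL₂-type over a real quadratic field with reducible p-torsion and supersingular reduction at an
inert p, today reachable only by
prime switching, FreitasLeHungSiksek2015) has no engine in print. Imported areas: mod-p
representation theory of GL₂(F_v) (GK
dimension, Iwasawa-algebra grade), non-commutative commutative algebra (Auslander regularity,
miracle flatness), pseudo-deformation
theory (SW nice primes, Pan). None of the cross-field menu (spectral/probabilistic/physical)
applies.

RANKED CRUXES. #0 ReducibleCrystallineModular (target) — SECTOR THEOREM X: F totally real, p ≥ 5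
with p ∤ disc F, O = valuation ring of ℚ̄_p; ρ : Γ_F → GL₂(ℚ̄_p) irreducible, totally odd (`IsOdd`),
a.e. unramified, with an upper-triangular integral model ρ₀ over O; at every v ∣ p: ρ₀ is
p-distinguished, ρ|Γ_{F_v} is crystalline for Fontaine's pinned datum and has pairwise distinct
τ-labelled Hodge–Tate weights ⟹ ∃ L-algebraic cuspidal π on GL₂(𝔸_F) with `SatakeFrobCompatibleAt ι
π ρ v` for cofinitely many v. No ordinarity, F_v arbitrary (unramified). (why it might fail: =
Fontaine–Mazur in this sector; known only ordinary (SW/Zhang) or F_v = ℚ_p (Pan/Zhang); false only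
if FM fails or the typing over-claims (p-distinguished but χ̄_a/χ̄_b = ω at v: Pan's p=3 caveat
survives at p ≥ 5 only heuristically).) [SkinnerWiles1999, Pan2022, Zhang2024, arXiv:2512.21249,
FontaineMazurGeometric1995]
#2 EisensteinGKBound (crux) — THE DOOR (Gee–Newton's codimension inequality at an Eisenstein maximal
ideal, growth form). F totally real, p ≥ 5, p ∤ disc F; D = (a,b)_F (a,b ∈ 𝓞_F ∖ 0) totally definite
and split above p; k a field of characteristic p; S ⊇ places over 2pab; χ₁, χ₂ : Γ_F → k^× with
Frobenius values c₁(v), c₂(v) at v ∉ S and χ₁ ≠ χ₂ on Γ_{F_v} for v ∣ p; U(r) = Ô^× ∩ (1 + p^r Ô)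
(coordinate order of D, so U(r)_v = 1 + p^r M₂(𝒪_v) at v ∣ p up to bounded index). CLAIM: ∃ C ∀ r,
every k-linearly independent family of forms f ∈ S(U(r), k) that are Eisenstein torsion — T_g f =
(c₁(v)+c₂(v)) f for all v ∉ S and every integral g of reduced norm a uniformizer at v and a unit
elsewhere — has at most C·p^(r[F:ℚ]) members. Equivalently GK-dim of π = lim S(U(r),k)[𝔪_Eis] over
∏_{v∣p} GL₂(F_v) is ≤ Σ_v [F_v:ℚ_p] (BHHMS normalisation), i.e. Gee–Newton's j_{k⟦K₀⟧}(fibre) ≥ dim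
B. [difficulty: L] (why it might fail: the wall may extend to the escaped clause: at Eisenstein 𝔪
the K₁- /Iwahori socle of S(U(1),k)[𝔪] need not be multiplicity-free (Mazur-type Eisenstein
multiplicity), voiding BHHMS Thm 1.4/1.6; cheapest falsifier = Brandt-module count of dim
S(U(r),𝔽₇)[𝔪_Eis], r ≤ 2, over ℚ(√5), 7 inert.) [BreuilEtAl2023, HuWang2020, GeeNewton2020,
BreuilPaskunas2012, CalegariEmerton2011]
#3 ProModularOfGKBound (crux) — THE ENGINE: the door implies PRO-MODULARITY of every ρ of the sector
— for F, p, O as in the target and ρ irreducible, totally odd, a.e. unramified, residually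
upper-triangular and p-distinguished at v ∣ p (NO condition at p otherwise), some tame level 𝒰 makes
ρ p-adically automorphic (`TameLevel.IsPadicallyAutomorphic`: associated with a continuous
ℚ̄_p-point of the completed-cohomology Hecke algebra 𝕋(K^p) of GL₂/F). Intended proof: Pan's
architecture (component C ∋ 𝔭_ρ of Spec R^ps of dim ≥ 1+2[F:ℚ] by the Galois Euler characteristic;
its ordinary locus is large and pro-modular by Skinner–Wiles/Zhang; pick a nice one-dimensional
characteristic-p prime 𝔮 in it) with the patching of completed homology of the totally definite
quaternion algebra at 𝔮, where Paškūnas' GL₂(ℚ_p) input is replaced by: semicontinuity of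
GK-dimension from 𝔪 to 𝔮 + the door + Gee–Newton's non-commutative Cohen–Macaulayness and MIRACLE
FLATNESS (GeeNewton2020 Prop. "big R = 𝕋") + Böckle–Iyengar–Paškūnas' structure of the unrestricted
local rings R_v^□ (domain, lci, any F_v); then JL/Hecke-algebra comparison to GL₂. [deps:
EisensteinGKBound] [difficulty: XL] (why it might fail: GN's miracle flatness is proved at a maximal
ideal under TW hypotheses; localising the grade/CM bookkeeping over R_∞⟦K₀⟧ at a one-dimensional
char-p prime, the semicontinuity of GK-dim from 𝔪 to 𝔮, and the SW/Zhang ordinary seed over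
non-abelian F may each fail.) [GeeNewton2020, Pan2022, SkinnerWiles1999, Zhang2024,
arXiv:2512.21249, arXiv:2110.01638]
#4 CrystallineProModularClassical (crux) — THE EXIT (classicality; typed WITHOUT residual hypotheses
so that it dedups with any GL₂/F route): F totally real, p ≥ 5, p ∤ disc F; ρ irreducible, totally
odd, a.e. unramified, p-adically automorphic of some tame level, crystalline with distinct labelled
HT weights at every v ∣ p ⟹ modular (L-algebraic cuspidal π, Satake matching a.e.). Intended proof:
the ℚ̄_p-point of 𝕋(K^p) transfers to the definite quaternionic completed Hecke algebra; Emerton's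
locally analytic Jacquet module gives a finite-slope overconvergent quaternionic/Hilbert eigenform
(a point of the eigenvariety) whose Galois representation is ρ; crystalline + HT-regular ⇒ the
refinement is classical of cohomological weight; small-slope / companion-form classicality
(PilloniStroh2016, Kassaei, Bijakowski; Breuil–Ding for F_v unramified) ⇒ classical, then JL to GL₂.
[difficulty: L] (why it might fail: passing from a completed-cohomology point to an overconvergent
eigenform needs a non-zero Jacquet module of the locally analytic vectors (trianguline local–global
compatibility): known for GL₂(ℚ_p), only partially for unramified F_v (Breuil–Ding, TW hypotheses);
critical slopes need companions.) [Emerton2011LocalGlobal, PilloniStroh2016,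
HansenUniversalEigenvarieties2017, Kisin2009, CalegariEmerton2011]
#9 SectorComplement (crux) — COMPLEMENT OF THE SECTOR = the rest of the summit:
`ReducibleCrystallineModular → Langlands` — every n ≠ 2, every F not totally real, direction (A),
the residually irreducible / non-crystalline / even parts of (B), local–global compatibility at
EVERY place and the reciprocity data 𝓡. NOT attacked by this route and not expected to close before
the summit; trivially implied by `Langlands`. Filed as a CRUX (not support) so that the deciding
theorem `closes : EisensteinGKBound → ProModularOfGKBound → CrystallineProModularClassical →
SectorComplement → Langlands` has every hypothesis declared (D-0027 §2.2; same convention as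
SkinnerWilesDefectOne.SectorComplement, QuadraticWindow.BeyondTheWindow). Graders/refuters: judge
the route on items 2–4 and the target, never on this item; never staff it from this route.
[difficulty: open-problem] (why it might fail: it IS the open reciprocity conjecture for GL_n
outside one GL₂/totally-real sector (all n, all F, direction (A), every place, 𝓡); `Langlands` as
typed may over-claim in corners (irregular π, even ρ). Imported complement; judge items 2/3/4.)
[BuzzardGeeLMS2014, FontaineMazurGeometric1995, Calegari2023]

TWO-LAYER PLAN. Foreseen glued splits (filed only when a crux closes or a prover proposes):
EisensteinGKBound ⇐ IwahoriSocleMultiplicity (the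
hypothesis of BreuilEtAl2023 Thm 1.6 for π = S(U(∞),k)[𝔪_Eis]: [π[𝔪³_I₁] : χ] = [π[𝔪_I₁] : χ]) →
GKCriterionEisenstein (Thm 1.6
applied; local, hypothesis-free) → EisensteinGKBound; ProModularOfGKBound ⇐ NicePrimeSeed (Pan's
large ordinary locus + SW/Zhang
pro-modularity over F, p unramified) → MiracleFlatnessAtNicePrime (GN Prop. big R = 𝕋 transposed to
𝔮) → ProModularOfGKBound;
CrystallineProModularClassical ⇐ OverconvergentOfProModular (Emerton Jacquet module, F_v unramified)
→ SmallSlopeClassical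
(Pilloni–Stroh/Kassaei + companion points) → CrystallineProModularClassical. Rank-n generalisation
NOT filed: the same door for
definite unitary groups U(n)/F⁺ at Eisenstein 𝔪 (ρ̄^ss = ⊕χ̄_i) would give residually reducible
non-ordinary automorphy lifting in
rank n (Thorne/ANT need ordinary + Steinberg) — a separate route once this one shows movement.

KILL CRITERIA. (K1) A Brandt-module computation (kit) exhibiting dim S(U(r),𝔽_p)[𝔪_Eis] growing
faster than p^(r[F:ℚ]) for some totally definite
D over a real quadratic F with p inert (r = 1,2,3 suffice to see exponent > [F:ℚ] if the socle has
large multiplicity) refutes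
EisensteinGKBound: close `refuted:EisensteinGKBound` — and record the wall extension "GK-dimension
jumps at Eisenstein 𝔪" in
Literature/Barriers/Langlands (informative either way). (K2) A proof that Gee–Newton's miracle
flatness CANNOT be localised at a
one-dimensional prime (e.g. grade not preserved) kills ProModularOfGKBound as drawn: pivot to
Zhang's potential pro-modularity via
abelian base change (arXiv:2512.21249 Step 2) with the door as the only new input. (K3) If X is
proved elsewhere (e.g. a GL₂(F_v)
p-adic local Langlands correspondence lands, or prime-switching covers the sector) the route is
mooted: close superseded.

NOT DECOMPOSED YET. Deliberately not decomposed at open: the JL/Hecke-algebra transfer from the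
definite quaternionic completed Hecke algebra to
`BigHeckeGLn.TameLevel` (bookkeeping inside the engine's proof); the choice of auxiliary place when
[F:ℚ] is odd; the genericity
strata of ρ̄_v (BHHMS's 12 ≤ r_i ≤ p−15 versus mere p-distinguishedness — a regime split of the
door, later); Leopoldt / dimension
of weight space; the p = 3 and p ∣ disc F cases; critical-slope companion points in the exit.

CHEAPEST FALSIFIER. Compute, for F = ℚ(√5), p = 7 (inert), D = (−1,−1)_F (totally definite, split at
7, class number small), tame level maximal, the
dimensions dim_𝔽₇ S(U(r), 𝔽₇)[𝔪] for r = 0,1,2 at the Eisenstein eigensystem 𝔪 = (T_v − (1 + Nv)):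
Brandt matrices for the
orders of level 7^r (a few thousand ideal classes at r = 2) — a kit job of minutes; compare the
growth with 7^(2r) (door) versus
7^(6r) (trivial bound) and, at r = 1, read off the K₁-socle multiplicities that BHHMS's criterion
needs. Not run in this planner
seat (no Brandt-module code in the folder; filed as the refuter's first move).

NUMBERS. GK-dimension target: dim_{GL₂(F_v)} π ≤ f = [F_v:ℚ_p] per place (BreuilEtAl2023 Thm 1.1:
equality for non-Eisenstein generic
𝔪, F_v unramified, p > 23 from genericity 12 ≤ r_i ≤ p − 15); Gee–Newton codimension dim B =
(n(n+1)/2 − 1)[F:ℚ] = 2[F:ℚ] for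
PGL₂ and Krull dim 𝕋_𝔪 = 1 + dim B − l₀ = 1 + 2[F:ℚ] (GeeNewton2020 Thm 2; Pan2022 Cor 1.0.3: 1 + 2
over ℚ; arXiv:2512.21249 Thm
1.2.2: equidimensional 1 + 2[F:ℚ] when p splits completely). Defect l₀ = 0 (totally real F, GL₂:
Literature.Barriers.Langlands
`defectGL_eq_zero_iff`).

DEFINITION REQUESTS. (1) Barrier-theorem candidate (lens output (a)), to be filed as a
`Literature/Barriers/Langlands` definition request:
`PaskunasCentreFinitenessFails` — for F_v/ℚ_p unramified of degree f ≥ 2, p ≥ 5 and a generic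
semisimple ρ̄_v, the block of smooth
𝔽̄_p[GL₂(F_v)]-representations cut out by W(ρ̄_v) contains infinitely many pairwise non-isomorphic
supersingular irreducibles
(BreuilPaskunas2012 Thm 1.5), hence admits no Noetherian commutative "centre" Z with Hom(P,·) finite
over Z for a projective
generator P — the finiteness ⊗̂_v R_v^ps → 𝕋_𝔪 of Pan2022 §3 / arXiv:2512.21249 Step 1 has no
analogue through a centre. (2)
Wanted facts (cite items, to be filed on open): GeeNewton2020 Prop. (big R = 𝕋 from the codimension
inequality); BreuilEtAl2023
Thm 1.6 (Iwahori criterion ⇒ GK ≤ f); Paskunas2013 Thm 1.5.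

Novelty: Searches (2026-08-17): lit search "residually reducible Galois representations totally real
modularity" (zbmath: 2 rows, SkinnerWiles1999, Skinner2003); lit search "Eisenstein points Hilbert
cuspidal eigenvariety" (zbmath 1: arXiv:2311.08361, read pp.2-3); lit search "adjoint Selmer groups
automorphic Galois representations unitary type" (NewtonThorne JEMS 2023, read intro); lit search
"Gelfand-Kirillov dimension mod p cohomology" (crossref 12: BreuilEtAl2023, DottoLe2021, HuWang2018
MRL, KoziolMorra2025 unitary rank 2); lit read arXiv:1609.06965 pp.1-5 (GeeNewton), arXiv:2009.03127
pp.1-5 (BHHMS), arXiv:1901.07166 pp.1-4 (Pan), arXiv:2512.21249 pp.1-5 and arXiv:2411.18661 (X.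
Zhang), arXiv:2210.10564 (Hernandez–Schraen), arXiv:1912.11265 (NT); lit galaxy search "even Galois
representation"/"Fontaine-Mazur" --star pdf (noise only); openalex/arxiv/s2 rate-limited (429)
during the session; lean search for quaternionic / completed-cohomology / trianguline vocabulary
(all constants `lean check`ed in Sketch.lean, rc 0); the 53 open Langlands routes read by
title/technique_class (none uses GK-dimension, BHHMS, Gee–Newton flatness or patching at Eisenstein
level at F_v ≠ ℚ_p; nearest SkinnerWilesDefectOne = imaginary quadratic, ordinary, Hida).
Nearest prior art found: BreuilEtAl2023 (doi:10.1007/s00222-023-01202-8) + HuWang2020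
(arXiv:2009.09640): GK-dim = [F_v:ℚ_p] and big R = 𝕋/flatness at NON-Eisenstein generic 𝔪 via TW
patching; GeeNewton2020: the codimension inequality ⇒ big R  [refs: 10.1007/s00222-023-01202-8, 10.1090/jams/991, 2311.08361, 1609.06965, 2009.03127, 1901.07166, 2512.21249, 2411.18661, 2210.10564, 1912.11265, 2009.09640, doi:10.1007/s00222-023-01202-8, doi:10.1090/jams/991, SkinnerWiles1999, BreuilEtAl2023, HuWang2020, GeeNewton2020, Pan2022, Zhang2024]

Barriers (technique_class: completed-cohomology gk-dimension miracle-flatness): - technique_class: completed-cohomology gk-dimension miracle-flatness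
- Literature.Barriers.Langlands.BreuilPaskunas2012_supersingularFamily: THE WALL INVERTED (catalogue
file ModPLanglandsGL2BeyondQp). Typed hypotheses of the technique it stops: (H1) the local input is
an identification of a local Galois (pseudo-)deformation ring with a representation-theoretic
algebra of GL₂(F_v) — Paskunas2013 Thm 1.5 (R_v^ps = Bernstein centre of the block) and projective
envelopes, resting on the classification "finitely many supersingulars per weight", whose failure
for F_v ≠ ℚ_p is the barrier's Lean content (`BreuilPaskunas2012_supersingularFamily`); (H2)
classicality through locally algebraic vectors of Π(ρ_v) (Colmez–Emerton); (H3) patching completed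
homology at nice primes (Pan). ESCAPED HYPOTHESIS: (H1) only — the door asks for a Gelfand–Kirillov
(codimension) BOUND on the 𝔪-fibre, a coarse invariant needing no classification or correspondence,
proven at non-Eisenstein 𝔪 for unramified F_v (BreuilEtAl2023) and sufficient for big R = 𝕋 by
GeeNewton2020; (H2) is confined to the exit crux and replaced there by overconvergent classicality;
(H3) is kept.
- Literature.Barriers.Langlands.ModPLanglandsGL2BeyondQpFpBar: same wall, 𝔽̄_p-coefficient form:
evaded identically (no correspondence for GL₂(F_v) is used or produced; the candidate Banach
representations of CEGGPS appear only as a by-product, as in BreuilEtAl2023 Thm 1.3).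
- Literature.Barriers.Langlands.ShimuraVarietyRealizationBarr

History (route lifecycle, newest last):
- 2026-08-17T05:17:28Z · rev 3: dropped PairLPoleJS, PairLBoundaryJS — route-repair (unused-crux, rrepair-96b3bdf5): DROP PairLPoleJS (stmt-Langlands-19093) and PairLBoundaryJS (stmt-Langlands-13622) from this route; closes unchang (planner-rrepair-Langlands-EisensteinGelfandKir-96b3bdf5-0)
- 2026-08-25T10:10:24Z · DORMANT — reconciler: no traction for 7.6 d (last activity item-evidence-added at 2026-08-17T19:11:10Z); parked, not closed — `ledger route dormant route-Langlands-Eisens (operator:999:3136638)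

sub-problem: Langlands · status: dormant · opened planner-plan-lens3-Langlands-barrier-0 2026-08-17T02:24:59Z · rev 3 · ledger route-Langlands-EisensteinGelfandKirillov
GENERATED by the gate from the ledger (D-0016/17). Provers cite these decls: `theorem foo : Summit.Langlands.Langlands.Theses.EisensteinGelfandKirillov.<Decl> := …` in Summits/Langlands/Langlands/Theorems/<Name>.lean.
-/

namespace Summit.Langlands.Langlands.Theses.EisensteinGelfandKirillov

open scoped BigOperators Topology Manifold Classical MeasureTheory ProbabilityTheory Matrix InnerProductSpace ComplexConjugate ContinuousMap
open Filter Set Function TopologicalSpace MeasureTheory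

attribute [summit_statement] _root_.Langlands

/-- item stmt-Langlands-18271 · target · rank 0 · open · by planner
why it might fail: = Fontaine–Mazur in this sector; known only ordinary (SW/Zhang) or F_v = ℚ_p (Pan/Zhang); false only if FM fails or the typing over-claims (p-distinguished but χ̄_a/χ̄_b = ω at v: Pan's p=3 caveat survives at p ≥ 5 only heuristically).
sources: SkinnerWiles1999, Pan2022, Zhang2024, arXiv:2512.21249, FontaineMazurGeometric1995
[target] SECTOR THEOREM X: F totally real, p ≥ 5 with p ∤ disc F, O = valuation ring of ℚ̄_p; ρ :
Γ_F → GL₂(ℚ̄_p) irreducible, totally odd (`IsOdd`), a.e. unramified, with an upper-triangular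
integral model ρ₀ over O; at every v ∣ p: ρ₀ is p-distinguished, ρ|Γ_{F_v} is crystalline for
Fontaine's pinned datum and has pairwise distinct τ-labelled Hodge–Tate weights ⟹ ∃ L-algebraic
cuspidal π on GL₂(𝔸_F) with `SatakeFrobCompatibleAt ι π ρ v` for cofinitely many v. No ordinarity,
F_v arbitrary (unramified). -/
@[route_item "route-Langlands-EisensteinGelfandKirillov"]
def ReducibleCrystallineModular : Prop :=
  ∀ (F : Type) [Field F] [NumberField F], NumberField.IsTotallyReal F → ∀ (p : ℕ) [Fact p.Prime], 5 ≤ p → ¬ ((p : ℤ) ∣ NumberField.discr F) → ∀ (O : ValuationSubring (PadicAlgCl p)), O = (Valued.v : Valuation (PadicAlgCl p) NNReal).valuationSubring → ∀ (hcpt : Literature.NumberTheory.Automorphic.isCompact_glFiniteIntegralLevel 2 F) (ι : PadicAlgCl p ≃+* ℂ) (ρ : Literature.NumberTheory.GaloisRepresentations.FramedGaloisRep F (PadicAlgCl p) 2) (ρ₀ : Field.absoluteGaloisGroup F →* Matrix.GeneralLinearGroup (Fin 2) O), ρ.toGaloisRep.IsIrreducible → ρ.IsOdd → (∀ᶠ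 v in cofinite, ρ.IsUnramifiedAt v) → ρ.HasUpperTriangularIntegralModel ρ₀ → (∀ (v : IsDedekindDomain.HeightOneSpectrum (NumberField.RingOfIntegers F)) (hv : ((p : ℕ) : NumberField.RingOfIntegers F) ∈ v.asIdeal), Literature.NumberTheory.GaloisRepresentations.IsPDistinguishedAt ρ₀ v ∧ (Literature.NumberTheory.PAdicHodge.fontainePstAdicCompletion v p hv).IsCrystallineFramed (ρ.toLocal v) ∧ (letI := (Literature.NumberTheory.PAdicHodge.fontainePstAdicCompletion v p hv).algebra; Literature.NumberTheory.GaloisRepresentations.GaloisRep.IsLabelledHodgeTateRegular (Literature.NumberTheory.PAdicHodge.fontainePstAdicCompletion v p hv).𝔅 (ρ.toLocal v).toGaloisRep)) → ∃ π : Literature.NumberTheory.Automorphic.CuspidalAutomorphicRepData 2 F hcpt, π.1.IsLAlgebraic ∧ ∀ᶠ v in cofinite, Summit.Langlands.SatakeFrobCompatibleAt ι π.1 ρ v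

/-- item stmt-Langlands-18272 · crux · rank 2 · open · by planner
why it might fail: the wall may extend to the escaped clause: at Eisenstein 𝔪 the K₁- /Iwahori socle of S(U(1),k)[𝔪] need not be multiplicity-free (Mazur-type Eisenstein multiplicity), voiding BHHMS Thm 1.4/1.6; cheapest falsifier = Brandt-module count of dim S(U(r),𝔽₇)[𝔪_Eis], r ≤ 2, over ℚ(√5), 7 inert.
sources: BreuilEtAl2023, HuWang2020, GeeNewton2020, BreuilPaskunas2012, CalegariEmerton2011
[crux] THE DOOR (Gee–Newton's codimension inequality at an Eisenstein maximal ideal, growth form). F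
totally real, p ≥ 5, p ∤ disc F; D = (a,b)_F (a,b ∈ 𝓞_F ∖ 0) totally definite and split above p; k a
field of characteristic p; S ⊇ places over 2pab; χ₁, χ₂ : Γ_F → k^× with Frobenius values c₁(v),
c₂(v) at v ∉ S and χ₁ ≠ χ₂ on Γ_{F_v} for v ∣ p; U(r) = Ô^× ∩ (1 + p^r Ô) (coordinate order of D, so
U(r)_v = 1 + p^r M₂(𝒪_v) at v ∣ p up to bounded index). CLAIM: ∃ C ∀ r, every k-linearly independent
family of forms f ∈ S(U(r), k) that are Eisenstein torsion — T_g f = (c₁(v)+c₂(v)) f for all v ∉ S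
and every integral g of reduced norm a uniformizer at v and a unit elsewhere — has at most
C·p^(r[F:ℚ]) members. Equivalently GK-dim of π = lim S(U(r),k)[𝔪_Eis] over ∏_{v∣p} GL₂(F_v) is ≤ Σ_v
[F_v:ℚ_p] (BHHMS normalisation), i.e. Gee–Newton's j_{k⟦K₀⟧}(fibre) ≥ dim B. [difficulty: L] -/
@[route_item "route-Langlands-EisensteinGelfandKirillov", crux]
def EisensteinGKBound : Prop :=
  ∀ (F : Type) [Field F] [NumberField F], NumberField.IsTotallyReal F → ∀ (p : ℕ) [Fact p.Prime], 5 ≤ p → ¬ ((p : ℤ) ∣ NumberField.discr F) → ∀ (a b : (NumberField.RingOfIntegers F)), a ≠ 0 → b ≠ 0 → let D := QuaternionAlgebra F (algebraMap _ F a) (0 : F) (algebraMap _ F b); Literature.NumberTheory.Automorphic.IsTotallyDefinite F D → (∀ v : IsDedekindDomain.HeightOneSpectrum (NumberField.RingOfIntegers F), (p : (NumberField.RingOfIntegers F)) ∈ v.asIdeal → Literature.NumberTheory.Automorphic.IsSplitAt D v) → ∀ (k : Type) [Field k] [CharP k p] [TopologicalSpace k] [DiscreteTopology k] (S : Finset (IsDedekindDomain.HeightOneSpectrum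 (NumberField.RingOfIntegers F))), (∀ v : IsDedekindDomain.HeightOneSpectrum (NumberField.RingOfIntegers F), ((2 * p : ℕ) : (NumberField.RingOfIntegers F)) * a * b ∈ v.asIdeal → v ∈ S) → ∀ (χ₁ χ₂ : Literature.NumberTheory.GaloisRepresentations.FramedGaloisRep F k 1) (c₁ c₂ : IsDedekindDomain.HeightOneSpectrum (NumberField.RingOfIntegers F) → k), (∀ v ∉ S, χ₁.IsUnramifiedAt v ∧ χ₂.IsUnramifiedAt v ∧ χ₁.HasFrobCharpolyAt v (Polynomial.X - Polynomial.C (c₁ v)) ∧ χ₂.HasFrobCharpolyAt v (Polynomial.X - Polynomial.C (c₂ v))) → (∀ v : IsDedekindDomain.HeightOneSpectrum (NumberField.RingOfIntegers F), (p : (NumberField.RingOfIntegers F)) ∈ v.asIdeal → ∃ σ, χ₁.toLocal v σ ≠ χ₂.toLocal v σ) → ∀ (U : ℕ → Subgroup (Literature.NumberTheory.Automorphic.finiteAdelicUnits F D)) [∀ r, IsHeckeTriple (⊤ : Submonoid (Literature.NumberTheory.Automorphic.finiteAdelicUnits F D)) (U r) (U r)], (∀ r u, u ∈ U r ↔ (u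 ∈ Literature.NumberTheory.Automorphic.QuaternionAlgebra.integralUnits a b ∧ ∀ i : Fin 4, ∃ y ∈ Literature.NumberTheory.Automorphic.integralFiniteAdeles F, Literature.NumberTheory.Automorphic.QuaternionAlgebra.adelicCoords a b (↑u - 1) i = ↑(p ^ r) * y)) → ∃ C : ℝ, ∀ (r : ℕ) (ι : Type) [Fintype ι] (f : ι → Literature.NumberTheory.Automorphic.QuaternionicForm D (U r) k), LinearIndependent k f → (∀ i, ∀ v ∉ S, ∀ g : Literature.NumberTheory.Automorphic.finiteAdelicUnits F D, (let x := Literature.NumberTheory.Automorphic.QuaternionAlgebra.adelicCoords a b ↑g; Literature.NumberTheory.Automorphic.QuaternionAlgebra.adelicEquiv a b ↑g ∈ Literature.NumberTheory.Automorphic.QuaternionAlgebra.adelicOrder a b ∧ let nrd : IsDedekindDomain.FiniteAdeleRing (NumberField.RingOfIntegers F) F := x 0 ^ 2 - algebraMap _ _ a * x 1 ^ 2 - algebraMap _ _ b * x 2 ^ 2 + algebraMap _ _ a * algebraMap _ _ b * x 3 ^ 2; ∀ w : IsDedekindDomain.HeightOneSpectrum (NumberField.RingOfIntegers F), Valued.v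 (nrd w) = if w = v then WithZero.exp (-1) else 1) → Literature.NumberTheory.Automorphic.QuaternionicForm.heckeOperator k g (f i) = (c₁ v + c₂ v) • f i) → (Fintype.card ι : ℝ) ≤ C * (p : ℝ) ^ (r * Module.finrank ℚ F)

/-- item stmt-Langlands-18273 · crux · rank 3 · open · by planner
why it might fail: GN's miracle flatness is proved at a maximal ideal under TW hypotheses; localising the grade/CM bookkeeping over R_∞⟦K₀⟧ at a one-dimensional char-p prime, the semicontinuity of GK-dim from 𝔪 to 𝔮, and the SW/Zhang ordinary seed over non-abelian F may each fail.
sources: GeeNewton2020, Pan2022, SkinnerWiles1999, Zhang2024, arXiv:2512.21249, arXiv:2110.01638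
[crux] THE ENGINE: the door implies PRO-MODULARITY of every ρ of the sector — for F, p, O as in the
target and ρ irreducible, totally odd, a.e. unramified, residually upper-triangular and
p-distinguished at v ∣ p (NO condition at p otherwise), some tame level 𝒰 makes ρ p-adically
automorphic (`TameLevel.IsPadicallyAutomorphic`: associated with a continuous ℚ̄_p-point of the
completed-cohomology Hecke algebra 𝕋(K^p) of GL₂/F). Intended proof: Pan's architecture (component C
∋ 𝔭_ρ of Spec R^ps of dim ≥ 1+2[F:ℚ] by the Galois Euler characteristic; its ordinary locus is large
and pro-modular by Skinner–Wiles/Zhang; pick a nice one-dimensional characteristic-p prime 𝔮 in it)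
with the patching of completed homology of the totally definite quaternion algebra at 𝔮, where
Paškūnas' GL₂(ℚ_p) input is replaced by: semicontinuity of GK-dimension from 𝔪 to 𝔮 + the door +
Gee–Newton's non-commutative Cohen–Macaulayness and MIRACLE FLATNESS (GeeNewton2020 Prop. "big R =
𝕋") + Böckle–Iyengar–Paškūnas' structure of the unrestricted local rings R_v^□ (domain, lci, any
F_v); then JL/Hecke-algebra comparison to GL₂. [deps: EisensteinGKBound] [difficulty: XL] -/
@[route_item "route-Langlands-EisensteinGelfandKirillov", crux]
def ProModularOfGKBound : Prop :=
  EisensteinGKBound → ∀ (F : Type) [Field F] [NumberField F], NumberField.IsTotallyReal F → ∀ (p : ℕ) [Fact p.Prime], 5 ≤ p → ¬ ((p : ℤ) ∣ NumberField.discr F) → ∀ (O : ValuationSubring (PadicAlgCl p)), O = (Valued.v : Valuation (PadicAlgCl p) NNReal).valuationSubring → ∀ (ρ : Literature.NumberTheory.GaloisRepresentations.FramedGaloisRep F (PadicAlgCl p) 2) (ρ₀ : Field.absoluteGaloisGroup F →* Matrix.GeneralLinearGroup (Fin 2) O), ρ.toGaloisRep.IsIrreducible → ρ.IsOdd → (∀ᶠ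 v in cofinite, ρ.IsUnramifiedAt v) → ρ.HasUpperTriangularIntegralModel ρ₀ → (∀ (v : IsDedekindDomain.HeightOneSpectrum (NumberField.RingOfIntegers F)), ((p : ℕ) : NumberField.RingOfIntegers F) ∈ v.asIdeal → Literature.NumberTheory.GaloisRepresentations.IsPDistinguishedAt ρ₀ v) → ∃ 𝒰 : Literature.NumberTheory.Automorphic.BigHeckeGLn.TameLevel 2 F p, 𝒰.IsPadicallyAutomorphic ρ

/-- item stmt-Langlands-18274 · crux · rank 4 · open · by planner
why it might fail: passing from a completed-cohomology point to an overconvergent eigenform needs a non-zero Jacquet module of the locally analytic vectors (trianguline local–global compatibility): known for GL₂(ℚ_p), only partially for unramified F_v (Breuil–Ding, TW hypotheses); critical slopes need companions.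
sources: Emerton2011LocalGlobal, PilloniStroh2016, HansenUniversalEigenvarieties2017, Kisin2009, CalegariEmerton2011
[crux] THE EXIT (classicality; typed WITHOUT residual hypotheses so that it dedups with any GL₂/F
route): F totally real, p ≥ 5, p ∤ disc F; ρ irreducible, totally odd, a.e. unramified, p-adically
automorphic of some tame level, crystalline with distinct labelled HT weights at every v ∣ p ⟹
modular (L-algebraic cuspidal π, Satake matching a.e.). Intended proof: the ℚ̄_p-point of 𝕋(K^p)
transfers to the definite quaternionic completed Hecke algebra; Emerton's locally analytic Jacquet
module gives a finite-slope overconvergent quaternionic/Hilbert eigenform (a point of the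
eigenvariety) whose Galois representation is ρ; crystalline + HT-regular ⇒ the refinement is
classical of cohomological weight; small-slope / companion-form classicality (PilloniStroh2016,
Kassaei, Bijakowski; Breuil–Ding for F_v unramified) ⇒ classical, then JL to GL₂. [difficulty: L] -/
@[route_item "route-Langlands-EisensteinGelfandKirillov", crux]
def CrystallineProModularClassical : Prop :=
  ∀ (F : Type) [Field F] [NumberField F], NumberField.IsTotallyReal F → ∀ (p : ℕ) [Fact p.Prime], 5 ≤ p → ¬ ((p : ℤ) ∣ NumberField.discr F) → ∀ (hcpt : Literature.NumberTheory.Automorphic.isCompact_glFiniteIntegralLevel 2 F) (ι : PadicAlgCl p ≃+* ℂ) (ρ : Literature.NumberTheory.GaloisRepresentations.FramedGaloisRep F (PadicAlgCl p) 2), ρ.toGaloisRep.IsIrreducible → ρ.IsOdd → (∀ᶠ v in cofinite, ρ.IsUnramifiedAt v) → (∃ 𝒰 : Literature.NumberTheory.Automorphic.BigHeckeGLn.TameLevel 2 F p, 𝒰.IsPadicallyAutomorphic ρ) → (∀ (v : IsDedekindDomain.HeightOneSpectrum (NumberField.RingOfIntegers F)) (hv : ((p : ℕ) : NumberField.RingOfIntegers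 F) ∈ v.asIdeal), (Literature.NumberTheory.PAdicHodge.fontainePstAdicCompletion v p hv).IsCrystallineFramed (ρ.toLocal v) ∧ (letI := (Literature.NumberTheory.PAdicHodge.fontainePstAdicCompletion v p hv).algebra; Literature.NumberTheory.GaloisRepresentations.GaloisRep.IsLabelledHodgeTateRegular (Literature.NumberTheory.PAdicHodge.fontainePstAdicCompletion v p hv).𝔅 (ρ.toLocal v).toGaloisRep)) → ∃ π : Literature.NumberTheory.Automorphic.CuspidalAutomorphicRepData 2 F hcpt, π.1.IsLAlgebraic ∧ ∀ᶠ v in cofinite, Summit.Langlands.SatakeFrobCompatibleAt ι π.1 ρ v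

/-- item stmt-Langlands-18275 · crux · rank 9 · open · by planner
why it might fail: it IS the open reciprocity conjecture for GL_n outside one GL₂/totally-real sector (all n, all F, direction (A), every place, 𝓡); `Langlands` as typed may over-claim in corners (irregular π, even ρ). Imported complement; judge items 2/3/4.
sources: BuzzardGeeLMS2014, FontaineMazurGeometric1995, Calegari2023
[crux] COMPLEMENT OF THE SECTOR = the rest of the summit: `ReducibleCrystallineModular → Langlands`
— every n ≠ 2, every F not totally real, direction (A), the residually irreducible / non-crystalline
/ even parts of (B), local–global compatibility at EVERY place and the reciprocity data 𝓡. NOT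
attacked by this route and not expected to close before the summit; trivially implied by
`Langlands`. Filed as a CRUX (not support) so that the deciding theorem `closes : EisensteinGKBound
→ ProModularOfGKBound → CrystallineProModularClassical → SectorComplement → Langlands` has every
hypothesis declared (D-0027 §2.2; same convention as SkinnerWilesDefectOne.SectorComplement,
QuadraticWindow.BeyondTheWindow). Graders/refuters: judge the route on items 2–4 and the target,
never on this item; never staff it from this route. [difficulty: open-problem] -/
@[route_item "route-Langlands-EisensteinGelfandKirillov", crux]
def SectorComplement : Prop :=
  ReducibleCrystallineModular → _root_.Langlands

/-- item stmt-Langlands-18276 · assembly · rank 1 · closed · proved by Summit.Langlands.Langlands.Theorems.eisensteinGelfandKirillov_assembly_proof @ 95b3e83d68cf (prover) · by planner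
sources: GeeNewton2020, Pan2022
[assembly] EisensteinGKBound → ProModularOfGKBound → CrystallineProModularClassical →
SectorComplement → Langlands (modus ponens through the target; identical in content to the deciding
theorem `closes`, provable now). -/
@[route_item "route-Langlands-EisensteinGelfandKirillov"]
def Assembly : Prop :=
  EisensteinGKBound → ProModularOfGKBound → CrystallineProModularClassical → SectorComplement → _root_.Langlands

/-! D-0027 §2.1 — DECIDING THEOREM (planner-authored via `route open/edit --closes-file`; by planner-plan-lens3-Langlands-barrier-0 2026-08-17T02:24:59Z):
its hypotheses are this route's items and its conclusion the sub-problem Statement (glue_lint), and it elaborates with this file. -/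

@[closes "route-Langlands-EisensteinGelfandKirillov"] theorem closes (h₂ : EisensteinGKBound) (h₃ : ProModularOfGKBound)
    (h₄ : CrystallineProModularClassical) (h₉ : SectorComplement) : _root_.Langlands := by
  refine h₉ ?_
  intro F _ _ hF p _ hp hdisc O hO hcpt ι ρ ρ₀ hirr hodd hur hup hloc
  have hpm := h₃ h₂ F hF p hp hdisc O hO ρ ρ₀ hirr hodd hur hup (fun v hv => (hloc v hv).1)
  exact h₄ F hF p hp hdisc hcpt ι ρ hirr hodd hur hpm (fun v hv => ⟨(hloc v hv).2.1, (hloc v hv).2.2⟩)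

end Summit.Langlands.Langlands.Theses.EisensteinGelfandKirillov
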